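import Summits.AtomisticToContinuum.HydrodynamicLimit.Theorems.RelayRaceLocalityLightConeInLawSVCLine
import Summits.AtomisticToContinuum.HydrodynamicLimit.Theorems.RelayRaceLocalityLightConeInLawStubProfileId
import Summits.AtomisticToContinuum.HydrodynamicLimit.Theorems.RelayRaceLocalityLightConeInLawStubProfileIdOne
import Summits.AtomisticToContinuum.HydrodynamicLimit.Theorems.RelayRaceLocalityNearConstantShortTimeHLStaticLLN
import Literature.Analysis.FluidPDE.HardSphereUniqueness
import Summits.AtomisticToContinuum.HydrodynamicLimit.Theorems.DensityCap.Negative.EosIdeal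

/-!
# Crux `LightConeInLaw` (stmt-AtomisticToContinuum-12500), line `susceptibility-variance-continuity`
— rung `cone_global_of_cover` (the GLOBAL regime of the stub `stub_cone`)

Support file (`--supports stmt-AtomisticToContinuum-12500`) proving the registered helper stub
`cone_global_of_cover` of the line `susceptibility-variance-continuity` (skeleton
`Cruxes/LightConeInLaw/Lines/susceptibility_variance_continuity.lean`, route `RelayRaceLocality`):
the commensurate two-copy light cone in law `stub_cone` (gas 1: `N + 1` spheres of diameter
`hsDiameter σ₁ N`, local Gibbs profile `(a₁, u₁, θ₁)`; gas 2: `n₂ N = ⌈(σ₂/σ₁)³ (N+1)⌉₊` spheres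
of the SAME diameter, profile `(a₂, u₂, θ₂)`; both with laws of large numbers at `t = 0` towards
classical hard-sphere Euler data that agree in reduced units on the ball `B(x₀, R)`), in the regime
`1 ≤ R`.

## Proof

No locality is involved: the minimal-image distance on `𝕋³` is `< 1`
(`DensityCapNegative.euclidDist_lt_one`, landed), so for `1 ≤ R` the agreement clause holds at
EVERY point.
1. Both `t = 0` laws of large numbers tested against `χ ≡ 1` force unit mass of `ρ₁(0)` and `ρ₂(0)`
   (`integral_eq_one_of_lln`; `n₂ N ≥ 1`), so the global agreement `ρ₁(0) σ₁³ = ρ₂(0) σ₂³`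
   integrates to `σ₁ = σ₂` (`sigma_eq_of_global_agreement`), whence `n₂ N = N + 1` for every `N`.
2. Profile identification (`ProfileIdOne.stub_profileIdOne`, for both gases — gas 2 is now an
   `(N+1)`-sphere local Gibbs family as well) gives `Uᵢ(0) = uᵢ`, `Θᵢ(0) = θᵢ`; with the global
   agreement, `u₁ = u₂` and `θ₁ = θ₂`.
3. The static law of large numbers with explicit activity inversion
   (`NearConstantShortTimeHL.staticLLN_explicit`) for both profiles at `σ₁`, uniqueness of limits in
   probability (`ProfileId.eq_of_tendsto_measure_lt_abs_sub`) and of continuous densities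
   (`ProfileId.eq_of_forall_integral_mul_eq`) identify `ρ₁(0) = ρa₁`, `ρ₂(0) = ρa₂`; the global
   agreement gives `ρa₁ = ρa₂`, and the two explicit inversions give `a₁ = e^{c₁ - c₂} a₂`.
4. A constant positive factor of the activity drops out of the canonical law
   (`MacroClosureLine.StubLedger.localGibbsLaw_const_mul`), so the two laws coincide, and two
   hard-sphere flows of the same `(ε, N)` agree Liouville-a.e. at every time
   (`HardSphereFlow.flow_eq_ae_holds`, GST 2013 Prop. 4.1.1); the law is absolutely continuous with
   respect to the Liouville measure, so the two expectations are equal for every `N`.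

The §1 lemmas are adapted from the standing disprover's work file
`Cruxes/LightConeInLaw/Disproof.lean` (§1, `integral_density_eq_one_of_lln`,
`sigma_eq_of_global_agreement`).

References: Gallagher–Saint-Raymond–Texier 2013, Prop. 4.1.1 (uniqueness of the hard-sphere flow);
H. Spohn, *Large Scale Dynamics of Interacting Particles* (1991), Part I Ch. 3 (local Gibbs states).
-/

namespace Summit.AtomisticToContinuum.HydrodynamicLimit.Theorems.LightConeInLawSVC.ConeGlobal

open scoped BigOperators Topology Classical ENNReal
open Filter Set MeasureTheory
open Literature.MathematicalPhysics.KineticTheory Literature.Analysis.FluidPDE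
  Literature.Analysis.FunctionSpaces
open Summit.AtomisticToContinuum.HydrodynamicLimit.Theorems.LightConeInLawSketch
open Summit.AtomisticToContinuum.HydrodynamicLimit.Theorems.LightConeInLawSVC

noncomputable section

/-! ### §1 Two structural facts (adapted from `Cruxes/LightConeInLaw/Disproof.lean` §1) -/

/-- **A law of large numbers for the density field forces unit mass of the target density.** If,
under probability measures `P N` on the phase space of `n N ≠ 0` spheres, the empirical density
field at flow-time `t` tested against `χ ≡ 1` converges in probability to `∫ 1 · ρ`, then `∫ ρ = 1`:
the empirical density of `χ ≡ 1` is identically `1` (`empiricalDensityField_one`). [folklore] -/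
theorem integral_eq_one_of_lln {n : ℕ → ℕ} (hn : ∀ N, n N ≠ 0)
    {P : (N : ℕ) → Measure (Config (n N) (Fin 3) T3)} (hP : ∀ N, IsProbabilityMeasure (P N))
    {ε : ℕ → ℝ} (Φ : (N : ℕ) → HardSphereFlow G3 (ε N) (n N)) {ρ : T3 → ℝ} {t : ℝ}
    (h : ∀ δ : ℝ, 0 < δ → Tendsto (fun N => P N {z | δ <
      |empiricalDensityField ((Φ N).flow t z) (fun _ => (1 : ℝ)) -
        ∫ x, (fun _ : T3 => (1 : ℝ)) x * ρ x|}) atTop (𝓝 0)) :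
    ∫ x, ρ x = 1 := by
  -- adapted from `Cruxes/LightConeInLaw/Disproof.lean` (`integral_density_eq_one_of_lln`)
  by_contra hne
  set I : ℝ := ∫ x, ρ x with hI
  have hk : 0 < |1 - I| := abs_pos.2 (sub_ne_zero.2 (Ne.symm hne))
  have h1 := h (|1 - I| / 2) (by positivity)
  have hint : ∫ x : T3, (fun _ : T3 => (1 : ℝ)) x * ρ x = I := by simp [hI]
  have huniv : ∀ N : ℕ, {z : Config (n N) (Fin 3) T3 | |1 - I| / 2 <
      |empiricalDensityField ((Φ N).flow t z) (fun _ => (1 : ℝ)) -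
        ∫ x : T3, (fun _ : T3 => (1 : ℝ)) x * ρ x|} = Set.univ := by
    intro N
    refine Set.eq_univ_of_forall fun z => ?_
    rw [Set.mem_setOf_eq, hint, empiricalDensityField_one (hn N)]
    linarith [le_abs_self (1 - I), neg_abs_le (1 - I), abs_nonneg (1 - I)]
  have h2 : Tendsto (fun _ : ℕ => (1 : ℝ≥0∞)) atTop (𝓝 0) := by
    refine h1.congr fun N => ?_
    haveI := hP N
    rw [huniv N, measure_univ]
  exact one_ne_zero (tendsto_const_nhds_iff.1 h2)

/-- **Global agreement forces equal reduced densities.** If `ρ₁ σ₁³ = ρ₂ σ₂³` pointwise on `𝕋³` for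
two densities of unit mass and `σ₁, σ₂ > 0`, then `σ₁ = σ₂` (integrate). [folklore] -/
theorem sigma_eq_of_global_agreement {ρ₁ ρ₂ : T3 → ℝ} {σ₁ σ₂ : ℝ} (hσ₁ : 0 < σ₁) (hσ₂ : 0 < σ₂)
    (h₁ : ∫ x, ρ₁ x = 1) (h₂ : ∫ x, ρ₂ x = 1) (h : ∀ x, ρ₁ x * σ₁ ^ 3 = ρ₂ x * σ₂ ^ 3) :
    σ₁ = σ₂ := by
  -- adapted from `Cruxes/LightConeInLaw/Disproof.lean` (`sigma_eq_of_global_agreement`)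
  have hint : ∫ x, ρ₁ x * σ₁ ^ 3 = ∫ x, ρ₂ x * σ₂ ^ 3 := integral_congr_ae (ae_of_all _ h)
  rw [integral_mul_const, integral_mul_const, h₁, h₂, one_mul, one_mul] at hint
  exact le_antisymm (le_of_pow_le_pow_left₀ three_ne_zero hσ₂.le hint.le)
    (le_of_pow_le_pow_left₀ three_ne_zero hσ₁.le hint.ge)

/-! ### §2 The rung -/

/-- **RUNG `cone_global_of_cover` — the global regime (`1 ≤ R`) of the commensurate two-copy light
cone in law `stub_cone`.** Verbatim `stub_cone` with the extra hypothesis `1 ≤ R`: the agreement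
ball covers `𝕋³` (`DensityCapNegative.euclidDist_lt_one`), so the two `t = 0` laws of large
numbers force `∫ ρᵢ(0) = 1` and `σ₁ = σ₂` (`sigma_eq_of_global_agreement`), hence `n₂ N = N + 1`;
profile identification (`ProfileIdOne.stub_profileIdOne`) gives `u₁ = u₂`, `θ₁ = θ₂`; the explicit activity inversion of
`NearConstantShortTimeHL.staticLLN_explicit` with uniqueness of limits in probability gives
`a₁ = e^{c₁ - c₂} a₂`; canonical laws do not see a constant activity factor
(`MacroClosureLine.StubLedger.localGibbsLaw_const_mul`), so `P₁ N = P₂ N`, and two hard-sphere flows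
of the same `(ε, N)` agree Liouville-a.e. (`HardSphereFlow.flow_eq_ae_holds`), so the difference of
the two expectations is `0` for every `N`. Constants: `η₀ = 1`, `c = 1`,
`σ₀ = min (σ₀ˢ(a₁, θ₁, u₁)) (σ₀ˢ(a₂, θ₂, u₂))` (the static-LLN thresholds). -/
theorem cone_global_of_cover :
    ∃ η₀ : ℝ, 0 < η₀ ∧ ∀ M : ℝ, 0 < M → ∃ c : ℝ, 0 < c ∧ ∀ (a₁ θ₁ a₂ θ₂ : T3 → ℝ) (u₁ u₂ : T3 → V3),
    Continuous a₁ → Continuous θ₁ → Continuous u₁ → Continuous a₂ → Continuous θ₂ → Continuous u₂ →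
    (∀ x, 0 < a₁ x) → (∀ x, 0 < θ₁ x) → (∀ x, 0 < a₂ x) → (∀ x, 0 < θ₂ x) → ∃ σ₀ : ℝ, 0 < σ₀ ∧ ∀
    (σ₁ σ₂ : ℝ), 0 < σ₁ → σ₁ < σ₀ → 0 < σ₂ → σ₂ < σ₀ → ∀ n₂ : ℕ → ℕ, (∀ N, n₂ N = ⌈(σ₂ / σ₁) ^ 3 *
    ((N + 1 : ℕ) : ℝ)⌉₊) → ∀ (T₁ T₂ : ℝ) (ρ₁ Θ₁ ρ₂ Θ₂ : ℝ → T3 → ℝ) (U₁ U₂ : ℝ → T3 → V3),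
    IsHardSphereEulerSolution σ₁ T₁ ρ₁ U₁ Θ₁ → IsHardSphereEulerSolution σ₂ T₂ ρ₂ U₂ Θ₂ → ∀ (Φ₁ :
    (N : ℕ) → HardSphereFlow (Torus.geometry (Fin 3)) (hsDiameter σ₁ N) (N + 1)) (Φ₂ : (N : ℕ) →
    HardSphereFlow (Torus.geometry (Fin 3)) (hsDiameter σ₁ N) (n₂ N)),
    let P₁ : (N : ℕ) → Measure (Config (N + 1) (Fin 3) T3) := fun N => localGibbsLaw σ₁ a₁ u₁ θ₁ N (Φ₁ N);
    let P₂ : (N : ℕ) → Measure (Config (n₂ N) (Fin 3) T3) := fun N => particleLaw (Φ₂ N) (canonicalDensity (Torus.geometry (Fin 3)) (hsDiameter σ₁ N) (n₂ N) (localGibbsProfile a₂ u₂ θ₂));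
    (∀ N, IsProbabilityMeasure (P₁ N)) → (∀ N, IsProbabilityMeasure (P₂ N)) → TendstoHydroFieldsAt
    P₁ Φ₁ ρ₁ U₁ Θ₁ 0 → (∀ χ : T3 → ℝ, Continuous χ → ∀ δ : ℝ, 0 < δ → Tendsto (fun N => P₂ N {z | δ
    < |empiricalDensityField ((Φ₂ N).flow 0 z) χ - ∫ x, χ x * ρ₂ 0 x|}) atTop (nhds 0) ∧ Tendsto
    (fun N => P₂ N {z | δ < ‖empiricalMomentumField ((Φ₂ N).flow 0 z) χ - ∫ x, (χ x * ρ₂ 0 x) • U₂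
    0 x‖}) atTop (nhds 0) ∧ Tendsto (fun N => P₂ N {z | δ < |empiricalEnergyField ((Φ₂ N).flow 0 z)
    χ - ∫ x, χ x * totalEnergyDensity (ρ₂ 0 x) (U₂ 0 x) (Θ₂ 0 x)|}) atTop (nhds 0)) → ∀ t : ℝ, 0 ≤
    t → t < T₁ → t < T₂ → (∀ s ∈ Set.Icc 0 t, ∀ x, ρ₁ s x * σ₁ ^ 3 < η₀ ∧ Θ₁ s x ≤ M ∧ ‖U₁ s x‖ ≤ M
    ∧ ρ₂ s x * σ₂ ^ 3 < η₀ ∧ Θ₂ s x ≤ M ∧ ‖U₂ s x‖ ≤ M) → ∀ (x₀ : T3) (R : ℝ), 1 ≤ R → (∀ x,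
    Torus.euclidDist x x₀ < R → ρ₁ 0 x * σ₁ ^ 3 = ρ₂ 0 x * σ₂ ^ 3 ∧ U₁ 0 x = U₂ 0 x ∧ Θ₁ 0 x = Θ₂ 0
    x) → ∀ χ : T3 → ℝ, Continuous χ → (∀ x, R - c * t ≤ Torus.euclidDist x x₀ → χ x = 0) → ∀ F : ℝ
    × V3 × ℝ → ℝ, LipschitzWith 1 F → (∀ p, |F p| ≤ 1) → Tendsto (fun N => (∫ z, F (σ₁ ^ 3 *
    empiricalDensityField ((Φ₁ N).flow t z) χ, (σ₁ ^ 3) • empiricalMomentumField ((Φ₁ N).flow t z)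
    χ, σ₁ ^ 3 * empiricalEnergyField ((Φ₁ N).flow t z) χ) ∂(P₁ N)) - ∫ z, F (σ₂ ^ 3 *
    empiricalDensityField ((Φ₂ N).flow t z) χ, (σ₂ ^ 3) • empiricalMomentumField ((Φ₂ N).flow t z)
    χ, σ₂ ^ 3 * empiricalEnergyField ((Φ₂ N).flow t z) χ) ∂(P₂ N)) atTop (nhds 0) := by
  refine ⟨1, one_pos, fun M _hM => ⟨1, one_pos, ?_⟩⟩
  intro a₁ θ₁ a₂ θ₂ u₁ u₂ ha₁ hθ₁ hu₁ ha₂ hθ₂ hu₂ ha₁0 hθ₁0 ha₂0 hθ₂0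
  obtain ⟨σs₁, hσs₁, Hs₁⟩ :=
    NearConstantShortTimeHL.staticLLN_explicit a₁ θ₁ u₁ ha₁ hθ₁ hu₁ ha₁0 hθ₁0
  obtain ⟨σs₂, hσs₂, Hs₂⟩ :=
    NearConstantShortTimeHL.staticLLN_explicit a₂ θ₂ u₂ ha₂ hθ₂ hu₂ ha₂0 hθ₂0
  refine ⟨min σs₁ σs₂, lt_min hσs₁ hσs₂, ?_⟩
  intro σ₁ σ₂ hσ₁ hσ₁' hσ₂ hσ₂' n₂ hn₂ T₁ T₂ ρ₁ Θ₁ ρ₂ Θ₂ U₁ U₂ hsol₁ hsol₂ Φ₁ Φ₂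
  dsimp only
  intro hP₁ hP₂ hL₁ hL₂ t ht htT₁ htT₂ _hguard x₀ R hR hagree χ _hχ _hsupp F _hF _hFb
  have hσ₁s : σ₁ < σs₁ := hσ₁'.trans_le (min_le_left _ _)
  have hσ₂s : σ₂ < σs₂ := hσ₂'.trans_le (min_le_right _ _)
  /- (0) the ball covers the torus: the agreement clause holds everywhere -/
  have hall : ∀ x, ρ₁ 0 x * σ₁ ^ 3 = ρ₂ 0 x * σ₂ ^ 3 ∧ U₁ 0 x = U₂ 0 x ∧ Θ₁ 0 x = Θ₂ 0 x :=
    fun x => hagree x ((DensityCapNegative.euclidDist_lt_one x x₀).trans_le hR)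
  /- (1) unit masses, `σ₁ = σ₂`, `n₂ N = N + 1` -/
  have hn₂0 : ∀ N, n₂ N ≠ 0 := fun N => by
    rw [hn₂ N]
    exact (Nat.ceil_pos.2 (by positivity)).ne'
  have hmass₁ : ∫ x, ρ₁ 0 x = 1 :=
    integral_eq_one_of_lln (n := fun N => N + 1) (fun N => Nat.succ_ne_zero N) hP₁ Φ₁
      (ρ := ρ₁ 0) (t := 0) fun δ hδ => (hL₁ (fun _ => 1) continuous_const δ hδ).1
  have hmass₂ : ∫ x, ρ₂ 0 x = 1 :=
    integral_eq_one_of_lln hn₂0 hP₂ Φ₂ (ρ := ρ₂ 0) (t := 0)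
      fun δ hδ => (hL₂ (fun _ => 1) continuous_const δ hδ).1
  have hσ : σ₁ = σ₂ := sigma_eq_of_global_agreement hσ₁ hσ₂ hmass₁ hmass₂ fun x => (hall x).1
  subst hσ
  have hn : n₂ = fun N => N + 1 := funext fun N => by
    rw [hn₂ N, div_self hσ₁.ne', one_pow, one_mul, Nat.ceil_natCast]
  subst hn
  beta_reduce at Φ₂ hP₂ hL₂ ⊢
  /- (2) profile identification: `Uᵢ(0) = uᵢ`, `Θᵢ(0) = θᵢ`, hence `u₁ = u₂`, `θ₁ = θ₂` -/
  have h0T₁ : (0 : ℝ) ∈ Set.Ico 0 T₁ := ⟨le_rfl, ht.trans_lt htT₁⟩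
  have h0T₂ : (0 : ℝ) ∈ Set.Ico 0 T₂ := ⟨le_rfl, ht.trans_lt htT₂⟩
  have hρ₁c : Continuous (ρ₁ 0) := (hsol₁.smooth_density.isSmooth_slice h0T₁).continuous
  have hρ₂c : Continuous (ρ₂ 0) := (hsol₂.smooth_density.isSmooth_slice h0T₂).continuous
  have hid₁ : ∀ x, U₁ 0 x = u₁ x ∧ Θ₁ 0 x = θ₁ x :=
    ProfileIdOne.stub_profileIdOne a₁ θ₁ u₁ ha₁ hθ₁ hu₁ ha₁0 hθ₁0 σ₁ hσ₁ Φ₁ hP₁ (ρ₁ 0) (Θ₁ 0)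
      (U₁ 0) hρ₁c (hsol₁.smooth_velocity.isSmooth_slice h0T₁).continuous
      (hsol₁.smooth_temperature.isSmooth_slice h0T₁).continuous (hsol₁.density_pos 0 h0T₁) hL₁
  have hid₂ : ∀ x, U₂ 0 x = u₂ x ∧ Θ₂ 0 x = θ₂ x :=
    ProfileIdOne.stub_profileIdOne a₂ θ₂ u₂ ha₂ hθ₂ hu₂ ha₂0 hθ₂0 σ₁ hσ₁ Φ₂ hP₂ (ρ₂ 0) (Θ₂ 0)
      (U₂ 0) hρ₂c (hsol₂.smooth_velocity.isSmooth_slice h0T₂).continuous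
      (hsol₂.smooth_temperature.isSmooth_slice h0T₂).continuous (hsol₂.density_pos 0 h0T₂) hL₂
  have hu : u₁ = u₂ := funext fun x => by rw [← (hid₁ x).1, ← (hid₂ x).1, (hall x).2.1]
  have hθ : θ₁ = θ₂ := funext fun x => by rw [← (hid₁ x).2, ← (hid₂ x).2, (hall x).2.2]
  subst hu
  subst hθ
  /- (3) static LLN with explicit inversion for both profiles at `σ₁`: `ρ₁(0) = ρa₁ = ρa₂ = ρ₂(0)`
  and `a₁ = e^{c₁ - c₂} a₂` -/
  obtain ⟨ρa₁, hρa₁c, -, -, ⟨c₁, hc₁⟩, H₁⟩ := Hs₁ σ₁ hσ₁ hσ₁s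
  obtain ⟨ρa₂, hρa₂c, -, -, ⟨c₂, hc₂⟩, H₂⟩ := Hs₂ σ₁ hσ₁ hσ₂s
  have hε0 : ∀ N, 0 < hsDiameter σ₁ N := fun N => hsDiameter_pos hσ₁ N
  have hεt : Tendsto (fun N => hsDiameter σ₁ N) atTop (𝓝 0) := tendsto_hsDiameter σ₁
  have hnε : Tendsto (fun N : ℕ => ((N + 1 : ℕ) : ℝ) * hsDiameter σ₁ N ^ 3) atTop (𝓝 (σ₁ ^ 3)) := by
    have heq : (fun N : ℕ => ((N + 1 : ℕ) : ℝ) * hsDiameter σ₁ N ^ 3) = fun _ => σ₁ ^ 3 :=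
      funext fun N => succ_mul_hsDiameter_pow_three σ₁ N
    rw [heq]
    exact tendsto_const_nhds
  have HL₁ := H₁ (fun N => hsDiameter σ₁ N) (fun N => N + 1) hε0 hεt hnε Φ₁ hP₁
  have HL₂ := H₂ (fun N => hsDiameter σ₁ N) (fun N => N + 1) hε0 hεt hnε Φ₂ hP₂
  haveI := hP₁
  haveI := hP₂
  have hρ₁a : ∀ x, ρ₁ 0 x = ρa₁ x :=
    ProfileId.eq_of_forall_integral_mul_eq hρ₁c hρa₁c fun χ' hχ' =>
      ProfileId.eq_of_tendsto_measure_lt_abs_sub (fun N => localGibbsLaw σ₁ a₁ u₁ θ₁ N (Φ₁ N))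
        (fun N z => empiricalDensityField ((Φ₁ N).flow 0 z) χ')
        (fun δ hδ => (hL₁ χ' hχ' δ hδ).1) (fun δ hδ => (HL₁ χ' hχ' δ hδ).1)
  have hρ₂a : ∀ x, ρ₂ 0 x = ρa₂ x :=
    ProfileId.eq_of_forall_integral_mul_eq hρ₂c hρa₂c fun χ' hχ' =>
      ProfileId.eq_of_tendsto_measure_lt_abs_sub (fun N => particleLaw (Φ₂ N)
          (canonicalDensity (Torus.geometry (Fin 3)) (hsDiameter σ₁ N) (N + 1)
            (localGibbsProfile a₂ u₁ θ₁)))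
        (fun N z => empiricalDensityField ((Φ₂ N).flow 0 z) χ')
        (fun δ hδ => (hL₂ χ' hχ' δ hδ).1) (fun δ hδ => (HL₂ χ' hχ' δ hδ).1)
  have hρa : ρa₁ = ρa₂ := funext fun x => by
    have h := (hall x).1
    rw [hρ₁a x, hρ₂a x] at h
    exact mul_right_cancel₀ (pow_ne_zero 3 hσ₁.ne') h
  subst hρa
  have ha : a₁ = fun x => Real.exp (c₁ - c₂) * a₂ x := funext fun x => by
    rw [hc₁ x, hc₂ x, Real.exp_sub]
    field_simp
  /- (4) the two laws coincide -/
  have hlaw : ∀ N, localGibbsLaw σ₁ a₁ u₁ θ₁ N (Φ₁ N) = particleLaw (Φ₂ N)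
      (canonicalDensity (Torus.geometry (Fin 3)) (hsDiameter σ₁ N) (N + 1)
        (localGibbsProfile a₂ u₁ θ₁)) := fun N => by
    rw [ha, MacroClosureLine.StubLedger.localGibbsLaw_const_mul (Φ₁ N) a₂ θ₁ u₁ (Real.exp_pos _)]
    rfl
  /- (5) flow uniqueness: the two integrands agree almost surely, for every `N` -/
  refine tendsto_const_nhds.congr fun N => ?_
  rw [eq_comm, sub_eq_zero, hlaw N]
  refine integral_congr_ae ?_
  have hac : particleLaw (Φ₂ N) (canonicalDensity (Torus.geometry (Fin 3)) (hsDiameter σ₁ N) (N + 1)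
      (localGibbsProfile a₂ u₁ θ₁)) ≪ liouville G3 (N + 1) (hsDiameter σ₁ N) :=
    withDensity_absolutelyContinuous _ _
  filter_upwards [hac.ae_le (HardSphereFlow.flow_eq_ae_holds (Φ₁ N) (Φ₂ N) t)] with z hz
  rw [hz]

end

end Summit.AtomisticToContinuum.HydrodynamicLimit.Theorems.LightConeInLawSVC.ConeGlobal
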